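import Summits.CriticalPhenomena.PercolationContinuityZ3.Theorems.PercNearOneGluingNoHeavyLowerTailIncStarHalfSchema
import Summits.CriticalPhenomena.PercolationContinuityZ3.Theorems.PercNearOneGluingNoHeavyLowerTailIncStarBridgeChordHalf
import Summits.CriticalPhenomena.PercolationContinuityZ3.Theorems.PercNearOneGluingNoHeavyLowerTailIncStarRSTree
import HarnessLib

/-!
# THEOREM C½: STAR½ on every apex-forest

Support file for the Sahi programme (`--supports stmt-CriticalPhenomena-4575`, prover prim-sahi-p2 gen 19).  No definitions, no named
facts, no sorries; standard axioms.  Memo `FROM-prim-nh-lead-4575-g120-STAR-HALF.md` (lead g120: STAR½, B½, C½, the RS-lemma) and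
`prim-sahi-p2/PROOF-E3.md` (29i)–(29m).

**Theorem `starHalf_nonneg_of_apexForest` (C½).**  For product Bernoulli percolation on the pairs of `Fin n`: if the non-root pairs of
positive weight form a forest, then for all targets `a, b, c`
`E₃({s↔a},{s↔b},{s↔c}) ≥ ½·(P(s↔a, s↔b, s↔c) − P(s↔a)P(s↔b)P(s↔c)) (≥ 0)` — STAR½, the sharpening of THEOREM C
(`IncStar.incStar_nonneg_of_apexForest`) by half the (nonnegative, Harris) triple covariance term.

**Proof.**  The schema `IncStar.starHalf_nonneg_of_apexForest_of_chordHalf` (THEOREM C's induction with `F` in place of `E₃`) applied to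
the B½ chord inequality `IncStar.incStar_bridge_chordHalf`, whose extra hypothesis `hRS ≥ 0` at the far endpoint of the bridge under
`w[e↦0]` is RS-forest, `IncStar.rs_nonneg` (the far side of an apex-forest bridge is again an apex-forest) — PROOF-E3 (29l)–(29m):
RS-forest ⟸ THEOREM Θ′ (`IncStar.theta_nonneg`, the two-target branch lemma) by the same-branch step `IncStar.rs_bridge_step_sameBranch`.
-/

noncomputable section

namespace Summit.CriticalPhenomena.PercolationContinuityZ3.Theorems

namespace IncStar

open MeasureTheory Set Literature.Probability.Percolation Literature.Probability.LatticeModels EdgeInduction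
open scoped Classical

variable {n : ℕ}

/-- **THEOREM C½ (STAR½ on apex-forests).** [this work] -/
theorem starHalf_nonneg_of_apexForest (w : Sym2 (Fin n) → unitInterval) (s a b c : Fin n)
    (hforest : (SimpleGraph.fromEdgeSet {z : Sym2 (Fin n) | s ∉ z ∧ w z ≠ 0}).IsAcyclic) :
    0 ≤ (sahiE3 (prodBernoulli w) (openConn s a) (openConn s b) (openConn s c)
        - 1 / 2 * ((prodBernoulli w).real (openConn s a ∩ openConn s b ∩ openConn s c)
          - (prodBernoulli w).real (openConn s a) * (prodBernoulli w).real (openConn s b) * (prodBernoulli w).real (openConn s c))) :=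
  starHalf_nonneg_of_apexForest_of_chordHalf
    (fun w L s u v _ b c hsL huL hvL haL hbL hcL _ hvs hcross hforest =>
      incStar_bridge_chordHalf w L hsL huL hvL haL hbL hcL hcross
        (rs_nonneg (Function.update w s(u, v) 0) b c hvs (hforest.anti (envGraph_update_le w s _ 0 (Or.inr rfl)))))
    w s a b c hforest

-- (The corollary 'C½ ⇒ C' was removed: THEOREM C is `IncStar.incStar_nonneg_of_apexForest` in `…IncStarApexForest`.)

end IncStar

end Summit.CriticalPhenomena.PercolationContinuityZ3.Theorems
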